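import Summits.NavierStokesRegularity.NavierStokesRegularity.Theses.TypeICertificateLadder
import Summits.NavierStokesRegularity.NavierStokesRegularity.Theorems.SqueezeCycleExtremalBiaxialitySubcriticalGaugeStrainBound
import Summits.NavierStokesRegularity.NavierStokesRegularity.Theorems.RellichScarSymmetricScarExistsGaussianWindowLaw
import Literature.Analysis.FluidPDE.TypeIAncientMildClassical
import Literature.Analysis.FluidPDE.AncientSimilarityVariables
import Literature.Analysis.FluidPDE.CaloricRemainderCalculus

/-!
# Crux `NoTypeIBlowup` (stmt-NavierStokesRegularity-1217), line `head-flux-channel`: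
  stub S2a `stub_gaussianDissipationContinuous` — CANDIDATE PROOF (drefute gen-4 side-product)

`D(s) = ∫ |∇U(s)|²_F e^{−|y|²/4} dy` is continuous in `s` for `U = lerayOrbit u`, `u` a Type-I
ancient mild field. Three accepted tree facts compose:

* `Theorems.exists_gauge_norm_fderiv_le_of_typeI C` — the CLASS-UNIFORM Leray-gauge gradient
  bound `(−t)‖∇u(t)(x)‖ ≤ K₀(C)` for every `t < 0` (KNSS 2009 Prop. 4.1, `k = 1`, transported by
  the Navier–Stokes zoom `isTypeIAncientMild_zoom`);
* `fderiv_lerayOrbit` — `∇U(s)(y) = e^{−s} ∇u(−e^{−s})(e^{−s/2}y)`, so `‖∇U(s)(y)‖ ≤ K₀` GLOBALLY;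
* `SymmetricScarExists.LogtimeBernoulli.continuous_integral_frobeniusNormSq_mul_gaussWeight`
  (sibling crux, accepted): continuity of `s ↦ ∫ |DU(s)|²_F g` for jointly smooth `U` with a
  global gradient bound (dominated convergence), `gaussWeight y = e^{−‖y‖²/4}` definitionally.

The theorem `gaussianDissipationContinuous` below has EXACTLY the type of the skeleton stub
(checked by the final `example`). For the lead to land `--supports stmt-NavierStokesRegularity-1217`.
-/

noncomputable section

namespace Summit.NavierStokesRegularity.NavierStokesRegularity.Cruxes.Target.HeadFluxChannelS2a

set_option linter.dupNamespace false

open MeasureTheory Set Filter Topology Function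
open scoped RealInnerProductSpace
open Literature.Analysis.FluidPDE
open Literature.Analysis.FluidPDE.PineauVicol2026
open Summit.NavierStokesRegularity.NavierStokesRegularity.Theorems
open Summit.NavierStokesRegularity.NavierStokesRegularity.Theorems.SymmetricScarExists.LogtimeBernoulli

/-- **Global Leray-gauge gradient bound in similarity variables**: for a Type-I ancient mild field
`u` with constant `C`, `‖∇U(s)(y)‖ ≤ K₀(C)` for ALL `s, y`, `U = lerayOrbit u`
(`exists_gauge_norm_fderiv_le_of_typeI` + `fderiv_lerayOrbit`). [cite: KochNadirashviliSereginSverak2009, Prop. 4.1 (4.10), k = 1 (arXiv:0709.3599 p. 8)] -/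
theorem exists_norm_fderiv_lerayOrbit_le (C : ℝ) :
    ∃ K₀ : ℝ, ∀ ⦃u : ℝ → EuclideanSpace ℝ (Fin 3) → EuclideanSpace ℝ (Fin 3)⦄,
      IsTypeIAncientMild C u → ∀ s y, ‖fderiv ℝ (lerayOrbit u s) y‖ ≤ K₀ := by
  obtain ⟨K₀, hK₀⟩ := exists_gauge_norm_fderiv_le_of_typeI C
  refine ⟨K₀, fun u hu s y => ?_⟩
  have ht : -Real.exp (-s) < 0 := neg_neg_of_pos (Real.exp_pos _)
  have h := hK₀ hu _ ht (Real.exp (-s / 2) • y)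
  rw [neg_neg] at h
  rw [fderiv_lerayOrbit, norm_smul, Real.norm_of_nonneg (Real.exp_pos _).le]
  exact h

/-- **The orbit of a class member is jointly smooth on all of similarity space–time**
(`contDiff_uncurry_lerayOrbit` on the class smoothness clause). [folklore] -/
theorem isSmoothSpaceTimeOn_lerayOrbit {C : ℝ}
    {u : ℝ → EuclideanSpace ℝ (Fin 3) → EuclideanSpace ℝ (Fin 3)} (hu : IsTypeIAncientMild C u) :
    IsSmoothSpaceTimeOn univ (lerayOrbit u) :=
  IsSmoothSpaceTimeOn.of_contDiff_univ (contDiff_uncurry_lerayOrbit hu.contDiffOn)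

/-- **S2a — continuity of the Gaussian dissipation** `s ↦ ∫ |∇U(s)|²_F e^{−‖y‖²/4}` along the
Leray orbit of a Type-I ancient mild field (dominated convergence with the class-uniform global
gradient bound; the verbatim stub of `Cruxes/Target/Lines/head-flux-channel.lean`). [folklore] -/
theorem gaussianDissipationContinuous :
    ∀ (C : ℝ) (u : ℝ → EuclideanSpace ℝ (Fin 3) → EuclideanSpace ℝ (Fin 3)),
      IsTypeIAncientMild C u →
      Continuous (fun s : ℝ =>
          ∫ y, frobeniusNormSq (fderiv ℝ (lerayOrbit u s) y) * Real.exp (-‖y‖ ^ 2 / 4)) := by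
  intro C u hu
  obtain ⟨K₀, hK₀⟩ := exists_norm_fderiv_lerayOrbit_le C
  exact continuous_integral_frobeniusNormSq_mul_gaussWeight (isSmoothSpaceTimeOn_lerayOrbit hu)
    (hK₀ hu)

/-- The theorem has exactly the type of the skeleton stub `stub_gaussianDissipationContinuous`. -/
example :
    ∀ (C : ℝ) (u : ℝ → EuclideanSpace ℝ (Fin 3) → EuclideanSpace ℝ (Fin 3)),
      IsTypeIAncientMild C u →
      Continuous (fun s : ℝ =>
          ∫ y, frobeniusNormSq (fderiv ℝ (lerayOrbit u s) y) * Real.exp (-‖y‖ ^ 2 / 4)) :=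
  gaussianDissipationContinuous

end Summit.NavierStokesRegularity.NavierStokesRegularity.Cruxes.Target.HeadFluxChannelS2a

end
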